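import Literature.NumberTheory.EllipticCurves.GaussSumJacobiChar
import Literature.NumberTheory.EllipticCurves.PAdicLFunctionNeZeroHoldsProofs
import Literature.NumberTheory.EllipticCurves.PAdicLFunctionMinus
import HarnessLib

/-!
# Birch's formula for the REAL quadratic characters with Gauss's sign: `∑ (a/D)[a/D]⁺_f · Ω⁺_f = √D · L(f, χ_D, 1)`
# (`D ≡ 1 (mod 4)`) and `∑ (a/D)[a/D]⁻_f · Ω⁻_f = √D · L(f, χ_D, 1)` (`D ≡ 3 (mod 4)`) — the
# "known in print" record behind PARI's `msfromell` normalisation and the census relation X4-1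

Topic `NumberTheory/EllipticCurves`; namespace `Literature.NumberTheory.EllipticCurves.ModularForms`.
Theorems only (no definition, no named fact; D-0026). For a rational newform `f ∈ S₂(Γ₀(N))`
(`IsNewform0 f`, `coeffField f = ⊥`) and an odd square-free `D` the tree has

* Birch's formula (Mazur–Tate–Teitelbaum 1986 §I.8 (8.6)) for EVEN primitive characters,
  `(∑_{a mod m} χ(a)[a/m]⁺_f) · Ω⁺_f = τ(χ) · L(f, χ̄, 1)` (`ratTwistedSymbolSum_mul_plusPeriod_holds`),
  and for ODD ones, `(∑ χ(a)[a/m]⁻_f) · Ω⁻_f · i = τ(χ) · L(f, χ̄, 1)`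
  (`ratMinusTwistedSymbolSum_mul_minusPeriod_mul_I`), the twisted `L`-value entering as `L 1` for
  any entire `L` agreeing with the twisted `L`-series on `Re s > 2`;
* Gauss's evaluation of the quadratic Gauss sum WITH SIGN (Montgomery–Vaughan Thm. 9.17):
  `τ(χ_D) = √D` for `D ≡ 1 (mod 4)`, `= i√D` for `D ≡ 3 (mod 4)`, `χ_D = (·/D)` the Jacobi character
  (`gaussSum_jacobiChar_of_mod_four_eq_one/three`).

This file records their composite, the SIGNED Birch formula for `χ_D = (·/D)` (`χ̄_D = χ_D`):

* `ratTwistedSymbolSum_jacobiChar_mul_plusPeriod` — `D ≡ 1 (mod 4)`: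
  `(∑_{a mod D} (a/D)[a/D]⁺_f) · Ω⁺_f = √D · L(f, χ_D, 1)`;
* `ratMinusTwistedSymbolSum_jacobiChar_mul_minusPeriod` — `D ≡ 3 (mod 4)`:
  `(∑_{a mod D} (a/D)[a/D]⁻_f) · Ω⁻_f = √D · L(f, χ_D, 1)` (the `i` of the odd formula cancels
  against the `i` of `τ(χ_D) = i√D`).

In the `Ω^±`-normalised symbols `x^± := (2πi∫f)^± / Ω^±` this is the identity
`∑_{0 ≤ a < |D*|} (D*|a) · x^{sgn D*}([a/|D*|] − [∞]) = √|D*| · L(f, (D*|·), 1)/Ω^{sgn D*}` for the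
fundamental discriminant `D* = χ_D(−1)·D` — the shape of the normalisation identity in the PARI/GP
documentation of `msfromell` (there with `Ω^±` the Néron periods of `E`, `Ω⁺ = E.omega[1]`,
`Ω⁻ = (2/c_∞)|Im E.omega[2]|`; beware that the tree's `Ω^±_f` include the number of real components,
`re Λ_f = ℤ·Ω⁺_f/2`, `im Λ_f = ℤ·Ω⁻_f/2`). Motivation: the BSD rank-`≤ 1` residual cell `b2b-bsdres`,
census cell (bsd-formula-census campaign X4-1, `run/shared/lean/ttrl/bsd-formula-census/X41-REPORT.md`):
the blind-fitted calibration relation at an additive prime `p` with a semistable twist,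
"`α♭⁻¹ · ∑_{a mod p} (a/p)·x^{sgn}_{E♭}({∞→a/p}) = α♭⁻¹ · c_∞(E) · L(E,1)/Ω_E`" on 852/852 rank-0
pairs, is — through `E = E♭ ⊗ χ_{p*}` and Pal's period relation — exactly this signed formula at
`D = p` (typed and proved problem-side in
`Summits/BirchSwinnertonDyer/Rank1Residual/Additive/CensusX41Calibration.lean`); this file is its
"known cases in print" record in Literature vocabulary (every odd square-free `D`, every rational
newform, no curve).

References: B. Mazur, J. Tate, J. Teitelbaum, Invent. Math. 84 (1986), Ch. I §8 (8.6)
[MazurTateTeitelbaum1986Invent]; H. L. Montgomery, R. C. Vaughan, *Multiplicative Number Theory I*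
(2007), §9.3 Thm. 9.17 [MontgomeryVaughan2007]; J. E. Cremona, *Algorithms for modular elliptic
curves* (1997) §2.8 (twisted `L`-values and `Ω^±`) [CremonaAlgorithms1997]; The PARI Group, PARI/GP
(`msfromell`, documentation of the normalisation of `x^±`).
-/

noncomputable section

open scoped MatrixGroups ModularForm NumberTheorySymbols

open CongruenceSubgroup Complex

namespace Literature.NumberTheory.EllipticCurves.ModularForms

open Literature.NumberTheory.QuadraticFields

variable {N : ℕ} [NeZero N] {f : CuspForm (Gamma0 N) 2} {D : ℕ} [NeZero D]

/-- For `D ≡ 1 (mod 4)` the Jacobi character `(·/D)` is EVEN: `(−1/D) = χ₄(D) = 1`. [folklore] -/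
private theorem jacobiChar_even_of_mod_four_eq_one' (hD : D % 4 = 1) : (jacobiChar D).Even := by
  have hodd : Odd D := Nat.odd_iff.mpr (by omega)
  show jacobiChar D (-1) = 1
  have h := jacobiChar_intCast (q := D) (-1)
  rw [Int.cast_neg, Int.cast_one] at h
  rw [h, jacobiSym.at_neg_one hodd, ZMod.χ₄_nat_one_mod_four hD, Int.cast_one]

/-- For `D ≡ 3 (mod 4)` the Jacobi character `(·/D)` is ODD (tree
`jacobiChar_neg_one_of_mod_four_eq_three`). [folklore] -/
private theorem jacobiChar_odd_of_mod_four_eq_three' (hD : D % 4 = 3) : (jacobiChar D).Odd :=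
  jacobiChar_neg_one_of_mod_four_eq_three hD

/-- **Birch's formula for `χ_D = (·/D)`, `D ≡ 1 (mod 4)` square-free, WITH SIGN:
`(∑_{a mod D} (a/D)[a/D]⁺_f) · Ω⁺_f = √D · L(f, χ_D, 1)`.** Here `f ∈ S₂(Γ₀(N))` is a rational
newform, `[r]⁺_f = ratPlusSymbol f r` (normalised by `Ω⁺_f = plusPeriod f`), and `L` is any entire
function agreeing with the twisted `L`-series `∑ χ_D(n) aₙ(f) n^{−s}` on `Re s > 2` (`χ̄_D = χ_D`).
Birch's formula (MTT 1986 (8.6), tree `ratTwistedSymbolSum_mul_plusPeriod_holds`) gives the left side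
`= τ(χ_D) · L 1`, and Gauss's theorem `τ(χ_D) = √D` (tree `gaussSum_jacobiChar_of_mod_four_eq_one`).
[cite: MazurTateTeitelbaum1986Invent, Ch. I §8 (8.6)] [cite: MontgomeryVaughan2007, §9.3 Thm. 9.17] -/
theorem ratTwistedSymbolSum_jacobiChar_mul_plusPeriod (hf : IsNewform0 f) (hQ : coeffField f = ⊥)
    (hsq : Squarefree D) (hD : D % 4 = 1) {L : ℂ → ℂ} (hL : Differentiable ℂ L)
    (hL' : ∀ s : ℂ, 2 < s.re → L s = twistedLSeries f (jacobiChar D) s) :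
    ratTwistedSymbolSum f (jacobiChar D) * (plusPeriod f : ℂ) = (Real.sqrt D : ℂ) * L 1 := by
  have hodd : Odd D := Nat.odd_iff.mpr (by omega)
  have hprim : (jacobiChar D).IsPrimitive := isPrimitive_jacobiChar hodd hsq
  have hinv : (jacobiChar D)⁻¹ = jacobiChar D := isQuadratic_jacobiChar.inv
  have hL'' : ∀ s : ℂ, 2 < s.re → L s = twistedLSeries f (jacobiChar D)⁻¹ s := by
    intro s hs; rw [hinv]; exact hL' s hs
  rw [ratTwistedSymbolSum_mul_plusPeriod_holds hf hQ hprim (jacobiChar_even_of_mod_four_eq_one' hD)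
    hL hL'', gaussSum_jacobiChar_of_mod_four_eq_one hsq hD]

/-- **Birch's formula for `χ_D = (·/D)`, `D ≡ 3 (mod 4)` square-free, WITH SIGN:
`(∑_{a mod D} (a/D)[a/D]⁻_f) · Ω⁻_f = √D · L(f, χ_D, 1)`** (`[r]⁻_f = ratMinusSymbol f r`,
`Ω⁻_f = minusPeriod f`; `L` any entire continuation of the `χ_D`-twisted `L`-series). The odd Birch
formula (tree `ratMinusTwistedSymbolSum_mul_minusPeriod_mul_I`) gives `(∑ …) · Ω⁻_f · i = τ(χ_D) · L 1`
and Gauss's theorem `τ(χ_D) = i√D` (tree `gaussSum_jacobiChar_of_mod_four_eq_three`); cancel `i`.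
[cite: MazurTateTeitelbaum1986Invent, Ch. I §8 (8.6)] [cite: MontgomeryVaughan2007, §9.3 Thm. 9.17] -/
theorem ratMinusTwistedSymbolSum_jacobiChar_mul_minusPeriod (hf : IsNewform0 f)
    (hQ : coeffField f = ⊥) (hsq : Squarefree D) (hD : D % 4 = 3) {L : ℂ → ℂ}
    (hL : Differentiable ℂ L) (hL' : ∀ s : ℂ, 2 < s.re → L s = twistedLSeries f (jacobiChar D) s) :
    ratMinusTwistedSymbolSum f (jacobiChar D) * (minusPeriod f : ℂ) = (Real.sqrt D : ℂ) * L 1 := by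
  have hodd : Odd D := Nat.odd_iff.mpr (by omega)
  have hprim : (jacobiChar D).IsPrimitive := isPrimitive_jacobiChar hodd hsq
  have hinv : (jacobiChar D)⁻¹ = jacobiChar D := isQuadratic_jacobiChar.inv
  have hL'' : ∀ s : ℂ, 2 < s.re → L s = twistedLSeries f (jacobiChar D)⁻¹ s := by
    intro s hs; rw [hinv]; exact hL' s hs
  have h := ratMinusTwistedSymbolSum_mul_minusPeriod_mul_I f hf hQ hprim
    (jacobiChar_odd_of_mod_four_eq_three' hD) hL hL''
  rw [gaussSum_jacobiChar_of_mod_four_eq_three hsq hD] at h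
  -- `X · i = i · √D · L 1` ⇒ `X = √D · L 1`
  have h0 : (ratMinusTwistedSymbolSum f (jacobiChar D) * (minusPeriod f : ℂ) -
      (Real.sqrt D : ℂ) * L 1) * Complex.I = 0 := by
    linear_combination h
  rcases mul_eq_zero.mp h0 with h1 | h1
  · exact sub_eq_zero.mp h1
  · exact absurd h1 Complex.I_ne_zero

/-- **The same two formulas as ONE statement indexed by the sign of `D* = (−1/D)·D`** (the shape of
PARI/GP's `msfromell` normalisation identity, in the tree's `Ω^±_f`-normalisation): for an odd
square-free `D`, `(∑ (a/D)[a/D]^{ε}_f) · Ω^{ε}_f = √D · L(f, χ_D, 1)` with `ε = +` iff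
`D ≡ 1 (mod 4)`. [cite: MazurTateTeitelbaum1986Invent, Ch. I §8 (8.6)]
[cite: MontgomeryVaughan2007, §9.3 Thm. 9.17] -/
theorem twistedSymbolSum_jacobiChar_mul_period_signed (hf : IsNewform0 f) (hQ : coeffField f = ⊥)
    (hsq : Squarefree D) (hodd : D % 2 = 1) {L : ℂ → ℂ} (hL : Differentiable ℂ L)
    (hL' : ∀ s : ℂ, 2 < s.re → L s = twistedLSeries f (jacobiChar D) s) :
    (if D % 4 = 1 then ratTwistedSymbolSum f (jacobiChar D) * (plusPeriod f : ℂ)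
      else ratMinusTwistedSymbolSum f (jacobiChar D) * (minusPeriod f : ℂ)) =
      (Real.sqrt D : ℂ) * L 1 := by
  by_cases hD : D % 4 = 1
  · rw [if_pos hD]
    exact ratTwistedSymbolSum_jacobiChar_mul_plusPeriod hf hQ hsq hD hL hL'
  · rw [if_neg hD]
    exact ratMinusTwistedSymbolSum_jacobiChar_mul_minusPeriod hf hQ hsq (by omega) hL hL'

end Literature.NumberTheory.EllipticCurves.ModularForms

end
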